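import Mathlib
import Summits.ValiantsHypothesis.ValiantsHypothesis.Theorems.ValuativeGCTValuativeFlipPencilBorderGradedSecond
import Summits.ValiantsHypothesis.ValiantsHypothesis.Theorems.ValuativeGCTValuativeFlipFourRowTransfer

/-!
# The SECOND-ORDER bordering chain: `H` from border ranks `r₂` of ONE explicit pencil pattern
# (crux `ValuativeGCT.ValuativeFlip`, stmt-ValiantsHypothesis-12624; wall-breaker axis k8 gen 1)

Helper file (`--supports stmt-ValiantsHypothesis-12624`), line `four-row-count`, `m`-free heart `H` of
`stub_fourRowPencilRank`.  Same chain as `…PencilBorderChain`, driven by the second-order graded bound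
`pencilRank_border_graded2`: along a pattern `b : ℕ → ℕ → (Fin 4 → ℂ)` with base size `n₁ + 1`,
  `s(M_{n₁+d+1}) ≥ s(b|_{n₁+1}) + Σ_{k<d} r₂(n₁+k+1)`      (`pencilRank_chain2`),
where `r₂(N)` is the rank of the `8N + 3` explicit three-variable polynomials built from the truncations
`B_N, B_{N+1}` of `b|_{y₄=0}` (zero post-base diagonal): `y_s per B_N`, `y_s Σ_l b_{Nl}| Per_{kl}(B_N)`,
`y_s Σ_k b_{kN}| Per_{kl}(B_N)` (`s < 3`), `Σ_l b_{Nl}| Per_{kl}(B_{N+1})`, `Σ_k b_{kN}| Per_{kl}(B_{N+1})`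
(`k, l < N`).  Hence `H` — and the registered stub `stub_fourRowPencilRank` VERBATIM — follow from
`6N + 2 ≤ r₂(N) + L` for all `N > n₁` for ONE pattern with four independent base cells
(`pencilCertificate_of_borderRanks2`, `fourRowPencilRank_of_borderRanks2`).
NUMERICS (seat folder `compute/pattern2.c`, exact ranks mod `2⁶¹-1`): `r₂(N) = 8N + 2` EXACTLY — the full
generic increment `s(N+1) - s(N)` of `4N² - 2N + 2` — for random patterns and for the explicit affine
pattern `b_ij = y₁ + i·y₂ + j·y₃` (`i ≠ j`, zero diagonal), `N = 11 … 14`; below `N = 11` it is the whole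
space of ternary forms of degree `N + 1`.  So the residual of the head's per-side heart is: for that one
pattern, `r₂(N) ≥ 6N + 2 - L` for all `N` (28 % slack against the numerical value `8N + 2`).
[this crux, line four-row-count; folklore]
-/

set_option linter.dupNamespace false

namespace Summit.ValiantsHypothesis.ValiantsHypothesis.Theorems.ValuativeFlip

open scoped BigOperators Matrix
open MvPolynomial Literature.Computability.AlgebraicComplexity Literature.NumberTheory.DiophantineGeometry

/-- **The second-order bordering chain.**  For a pattern `b : ℕ → ℕ → (Fin 4 → ℂ)` and a base size `n₁ + 1`, at
every size `n₁ + d + 1` there is a four-variable pencil `M` agreeing with `b` off the post-base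
diagonal, with `y₄`-multiples on the post-base diagonal, and with
`s(M) ≥ s(b|_{n₁+1}) + Σ_{k<d} r_b(n₁+k+1)` (`r_b` as in the module docstring, written out).
[this crux, line four-row-count; folklore] -/
theorem pencilRank_chain2 (n₁ : ℕ) (b : ℕ → ℕ → Fin 4 → ℂ) (d : ℕ) :
    ∃ M : Fin (n₁ + d + 1) × Fin (n₁ + d + 1) → Fin 4 → ℂ,
      (∀ i j : Fin (n₁ + d + 1), ((i : ℕ) ≠ (j : ℕ) ∨ (i : ℕ) < n₁ + 1) → M (i, j) = b i j) ∧
      (∀ i : Fin (n₁ + d + 1), n₁ + 1 ≤ (i : ℕ) → ∀ s : Fin 3, M (i, i) (Fin.castSucc s) = 0) ∧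
      Module.finrank ℂ ↥(Submodule.span ℂ (Set.range fun tc : Fin 4 × (Fin (n₁ + 1) × Fin (n₁ + 1)) =>
          (X tc.1 : MvPolynomial (Fin 4) ℂ) *
            aeval (fun ij : Fin (n₁ + 1) × Fin (n₁ + 1) => ∑ t : Fin 4, b ij.1 ij.2 t • (X t : MvPolynomial (Fin 4) ℂ))
              (pderiv tc.2 (perPoly (Fin (n₁ + 1)) ℂ)))) +
      ∑ k ∈ Finset.range d, Module.finrank ℂ ↥(
        Submodule.span ℂ (Set.range fun s : Fin 3 =>
          (X s : MvPolynomial (Fin 3) ℂ) *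
            aeval (fun ij : Fin (n₁ + k + 1) × Fin (n₁ + k + 1) => ∑ s : Fin 3,
                (if ((ij.1 : ℕ) = (ij.2 : ℕ) ∧ n₁ + 1 ≤ (ij.1 : ℕ)) then (0 : ℂ) else b ij.1 ij.2 (Fin.castSucc s)) •
                  (X s : MvPolynomial (Fin 3) ℂ))
              (perPoly (Fin (n₁ + k + 1)) ℂ))
        ⊔ Submodule.span ℂ (Set.range fun sk : Fin 3 × Fin (n₁ + k + 1) =>
          (X sk.1 : MvPolynomial (Fin 3) ℂ) *
            ∑ l : Fin (n₁ + k + 1), (∑ s : Fin 3, b (n₁ + k + 1) l (Fin.castSucc s) • (X s : MvPolynomial (Fin 3) ℂ)) *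
              aeval (fun ij : Fin (n₁ + k + 1) × Fin (n₁ + k + 1) => ∑ s : Fin 3,
                  (if ((ij.1 : ℕ) = (ij.2 : ℕ) ∧ n₁ + 1 ≤ (ij.1 : ℕ)) then (0 : ℂ) else b ij.1 ij.2 (Fin.castSucc s)) •
                    (X s : MvPolynomial (Fin 3) ℂ))
                (pderiv (sk.2, l) (perPoly (Fin (n₁ + k + 1)) ℂ)))
        ⊔ Submodule.span ℂ (Set.range fun sl : Fin 3 × Fin (n₁ + k + 1) =>
          (X sl.1 : MvPolynomial (Fin 3) ℂ) *
            ∑ k' : Fin (n₁ + k + 1), (∑ s : Fin 3, b k' (n₁ + k + 1) (Fin.castSucc s) • (X s : MvPolynomial (Fin 3) ℂ)) *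
              aeval (fun ij : Fin (n₁ + k + 1) × Fin (n₁ + k + 1) => ∑ s : Fin 3,
                  (if ((ij.1 : ℕ) = (ij.2 : ℕ) ∧ n₁ + 1 ≤ (ij.1 : ℕ)) then (0 : ℂ) else b ij.1 ij.2 (Fin.castSucc s)) •
                    (X s : MvPolynomial (Fin 3) ℂ))
                (pderiv (k', sl.2) (perPoly (Fin (n₁ + k + 1)) ℂ)))
        ⊔ Submodule.span ℂ (Set.range fun k' : Fin (n₁ + k + 1) =>
            ∑ l : Fin (n₁ + k + 1), (∑ s : Fin 3, b (n₁ + k + 1) l (Fin.castSucc s) • (X s : MvPolynomial (Fin 3) ℂ)) *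
              aeval (fun ij : Fin (n₁ + k + 2) × Fin (n₁ + k + 2) => ∑ s : Fin 3,
                  (if ((ij.1 : ℕ) = (ij.2 : ℕ) ∧ n₁ + 1 ≤ (ij.1 : ℕ)) then (0 : ℂ) else b ij.1 ij.2 (Fin.castSucc s)) •
                    (X s : MvPolynomial (Fin 3) ℂ))
                (pderiv (Fin.castSucc k', Fin.castSucc l) (perPoly (Fin (n₁ + k + 2)) ℂ)))
        ⊔ Submodule.span ℂ (Set.range fun l : Fin (n₁ + k + 1) =>
            ∑ k' : Fin (n₁ + k + 1), (∑ s : Fin 3, b k' (n₁ + k + 1) (Fin.castSucc s) • (X s : MvPolynomial (Fin 3) ℂ)) *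
              aeval (fun ij : Fin (n₁ + k + 2) × Fin (n₁ + k + 2) => ∑ s : Fin 3,
                  (if ((ij.1 : ℕ) = (ij.2 : ℕ) ∧ n₁ + 1 ≤ (ij.1 : ℕ)) then (0 : ℂ) else b ij.1 ij.2 (Fin.castSucc s)) •
                    (X s : MvPolynomial (Fin 3) ℂ))
                (pderiv (Fin.castSucc k', Fin.castSucc l) (perPoly (Fin (n₁ + k + 2)) ℂ)))) ≤
      Module.finrank ℂ ↥(Submodule.span ℂ (Set.range fun tc : Fin 4 × (Fin (n₁ + d + 1) × Fin (n₁ + d + 1)) =>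
          (X tc.1 : MvPolynomial (Fin 4) ℂ) *
            aeval (fun ij : Fin (n₁ + d + 1) × Fin (n₁ + d + 1) => ∑ t : Fin 4, M ij t • (X t : MvPolynomial (Fin 4) ℂ))
              (pderiv tc.2 (perPoly (Fin (n₁ + d + 1)) ℂ)))) := by
  induction d with
  | zero =>
    refine ⟨fun ij => b ij.1 ij.2, fun i j _ => rfl, fun i hi => absurd i.isLt (by omega), ?_⟩
    rw [Finset.sum_range_zero, add_zero]
  | succ d ih =>
    obtain ⟨M, hM1, hM2, hM3⟩ := ih
    -- the corner-free border of `M` by the next column and row of `b`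
    let M₀ : Fin (n₁ + d + 2) × Fin (n₁ + d + 2) → Fin 4 → ℂ := fun p =>
      Fin.snoc (α := fun _ => Fin 4 → ℂ)
        (fun i : Fin (n₁ + d + 1) => (Fin.snoc (α := fun _ => Fin 4 → ℂ)
          (fun j : Fin (n₁ + d + 1) => M (i, j)) (b i (n₁ + d + 1)) : Fin (n₁ + d + 2) → Fin 4 → ℂ) p.2)
        ((Fin.snoc (α := fun _ => Fin 4 → ℂ) (fun j : Fin (n₁ + d + 1) => b (n₁ + d + 1) j) 0
          : Fin (n₁ + d + 2) → Fin 4 → ℂ) p.2) p.1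
    have h₀₁₁ : ∀ i j, M₀ (Fin.castSucc i, Fin.castSucc j) = M (i, j) := by intro i j; simp [M₀]
    have h₀₁₂ : ∀ i, M₀ (Fin.castSucc i, Fin.last (n₁ + d + 1)) = b i (n₁ + d + 1) := by intro i; simp [M₀]
    have h₀₂₁ : ∀ j, M₀ (Fin.last (n₁ + d + 1), Fin.castSucc j) = b (n₁ + d + 1) j := by intro j; simp [M₀]
    have h₀₂₂ : M₀ (Fin.last (n₁ + d + 1), Fin.last (n₁ + d + 1)) = 0 := by simp [M₀]
    obtain ⟨c, M', hc, h11, h12, h21, h22, hrank⟩ :=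
      pencilRank_border_graded2 (n₁ + d) M (fun i => b i (n₁ + d + 1)) (fun j => b (n₁ + d + 1) j)
        M₀ h₀₁₁ h₀₁₂ h₀₂₁ h₀₂₂
    refine ⟨M', ?_, ?_, ?_⟩
    · intro i j hij
      induction i using Fin.lastCases with
      | last =>
        induction j using Fin.lastCases with
        | last => exact absurd hij (by simp [Fin.val_last])
        | cast j => refine (h21 j).trans ?_; simp [Nat.add_assoc]
      | cast i =>
        induction j using Fin.lastCases with
        | last => refine (h12 i).trans ?_; simp [Nat.add_assoc]
        | cast j =>
          refine (h11 i j).trans ?_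
          rw [hM1 i j (by simpa using hij)]
          simp
    · intro i hi s
      induction i using Fin.lastCases with
      | last =>
        refine (congrFun h22 (Fin.castSucc s)).trans ?_
        exact Pi.single_eq_of_ne (Fin.castSucc_lt_last s).ne _
      | cast i =>
        refine (congrFun (h11 i i) (Fin.castSucc s)).trans ?_
        exact hM2 i (by simpa using hi) s
    · -- the restriction of `M` to `y₄ = 0` is the zero-diagonal truncation of `b`
      have hBz : (fun ij : Fin (n₁ + d + 1) × Fin (n₁ + d + 1) => ∑ s : Fin 3,
            M ij (Fin.castSucc s) • (X s : MvPolynomial (Fin 3) ℂ)) =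
          fun ij : Fin (n₁ + d + 1) × Fin (n₁ + d + 1) => ∑ s : Fin 3,
            (if ((ij.1 : ℕ) = (ij.2 : ℕ) ∧ n₁ + 1 ≤ (ij.1 : ℕ)) then (0 : ℂ) else b ij.1 ij.2 (Fin.castSucc s)) •
              (X s : MvPolynomial (Fin 3) ℂ) := by
        funext ij
        refine Finset.sum_congr rfl fun s _ => ?_
        obtain ⟨i, j⟩ := ij
        by_cases h : ((i : ℕ) = (j : ℕ) ∧ n₁ + 1 ≤ (i : ℕ))
        · have hji : j = i := Fin.ext h.1.symm
          subst hji
          rw [if_pos h, hM2 j h.2 s]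
        · rw [if_neg h, hM1 i j (by omega)]
      have hBz₀ : (fun ij : Fin (n₁ + d + 2) × Fin (n₁ + d + 2) => ∑ s : Fin 3,
            M₀ ij (Fin.castSucc s) • (X s : MvPolynomial (Fin 3) ℂ)) =
          fun ij : Fin (n₁ + d + 2) × Fin (n₁ + d + 2) => ∑ s : Fin 3,
            (if ((ij.1 : ℕ) = (ij.2 : ℕ) ∧ n₁ + 1 ≤ (ij.1 : ℕ)) then (0 : ℂ) else b ij.1 ij.2 (Fin.castSucc s)) •
              (X s : MvPolynomial (Fin 3) ℂ) := by
        funext ij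
        refine Finset.sum_congr rfl fun s _ => ?_
        obtain ⟨i, j⟩ := ij
        congr 1
        induction i using Fin.lastCases with
        | last =>
          induction j using Fin.lastCases with
          | last => rw [if_pos ⟨rfl, by simp [Fin.val_last]⟩]; exact congrFun h₀₂₂ _
          | cast j =>
            rw [if_neg (by simp [Fin.val_last]; omega)]
            exact (congrFun (h₀₂₁ j) _).trans (by simp)
        | cast i =>
          induction j using Fin.lastCases with
          | last =>
            rw [if_neg (by simp [Fin.val_last]; omega)]
            exact (congrFun (h₀₁₂ i) _).trans (by simp)
          | cast j =>
            rw [show M₀ (Fin.castSucc i, Fin.castSucc j) = M (i, j) from h₀₁₁ i j]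
            by_cases h : ((i : ℕ) = (j : ℕ) ∧ n₁ + 1 ≤ (i : ℕ))
            · have hji : j = i := Fin.ext h.1.symm
              subst hji
              rw [if_pos (by simpa using h), hM2 j h.2 s]
            · rw [if_neg (by simpa using h), hM1 i j (by omega)]
              simp
      rw [hBz, hBz₀] at hrank
      rw [Finset.sum_range_succ, ← add_assoc]
      exact le_trans (Nat.add_le_add_right hM3 _) hrank

/-- **`H` from second-order border ranks of one pattern.**  If a pattern `b` has four independent
coordinate cells in its base block `n₁ + 1` and its border ranks satisfy `r_b(n₁+k+1) + L ≥ 6(n₁+k+1) + 2`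
for every `k` (corank at most `L` beyond the generic single Laplace relation … numerically the generic
value is `r_b(N) = 6N + 2`), then the `m`-free pencil-certificate hypothesis `H` of
`fourRowPencilRank_of_pencilCertificate` holds verbatim: `Σ_{k<d} (6(n₁+k+1)+2) = 3d² + (6n₁+5)d`
eventually exceeds `2(6n/5)² + 6n/5 + 2 + dL`, `n = n₁ + d + 1`. [this crux, line four-row-count] -/
theorem pencilCertificate_of_borderRanks2 (n₁ : ℕ) (b : ℕ → ℕ → Fin 4 → ℂ)
    (cells : Fin 4 → Fin (n₁ + 1) × Fin (n₁ + 1))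
    (hcells : IsUnit (Matrix.of fun t t' : Fin 4 => b (cells t').1 (cells t').2 t)) (L : ℕ)
    (hr : ∀ k : ℕ, 6 * (n₁ + k + 1) + 2 ≤ Module.finrank ℂ ↥(
        Submodule.span ℂ (Set.range fun s : Fin 3 =>
          (X s : MvPolynomial (Fin 3) ℂ) *
            aeval (fun ij : Fin (n₁ + k + 1) × Fin (n₁ + k + 1) => ∑ s : Fin 3,
                (if ((ij.1 : ℕ) = (ij.2 : ℕ) ∧ n₁ + 1 ≤ (ij.1 : ℕ)) then (0 : ℂ) else b ij.1 ij.2 (Fin.castSucc s)) •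
                  (X s : MvPolynomial (Fin 3) ℂ))
              (perPoly (Fin (n₁ + k + 1)) ℂ))
        ⊔ Submodule.span ℂ (Set.range fun sk : Fin 3 × Fin (n₁ + k + 1) =>
          (X sk.1 : MvPolynomial (Fin 3) ℂ) *
            ∑ l : Fin (n₁ + k + 1), (∑ s : Fin 3, b (n₁ + k + 1) l (Fin.castSucc s) • (X s : MvPolynomial (Fin 3) ℂ)) *
              aeval (fun ij : Fin (n₁ + k + 1) × Fin (n₁ + k + 1) => ∑ s : Fin 3,
                  (if ((ij.1 : ℕ) = (ij.2 : ℕ) ∧ n₁ + 1 ≤ (ij.1 : ℕ)) then (0 : ℂ) else b ij.1 ij.2 (Fin.castSucc s)) •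
                    (X s : MvPolynomial (Fin 3) ℂ))
                (pderiv (sk.2, l) (perPoly (Fin (n₁ + k + 1)) ℂ)))
        ⊔ Submodule.span ℂ (Set.range fun sl : Fin 3 × Fin (n₁ + k + 1) =>
          (X sl.1 : MvPolynomial (Fin 3) ℂ) *
            ∑ k' : Fin (n₁ + k + 1), (∑ s : Fin 3, b k' (n₁ + k + 1) (Fin.castSucc s) • (X s : MvPolynomial (Fin 3) ℂ)) *
              aeval (fun ij : Fin (n₁ + k + 1) × Fin (n₁ + k + 1) => ∑ s : Fin 3,
                  (if ((ij.1 : ℕ) = (ij.2 : ℕ) ∧ n₁ + 1 ≤ (ij.1 : ℕ)) then (0 : ℂ) else b ij.1 ij.2 (Fin.castSucc s)) •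
                    (X s : MvPolynomial (Fin 3) ℂ))
                (pderiv (k', sl.2) (perPoly (Fin (n₁ + k + 1)) ℂ)))
        ⊔ Submodule.span ℂ (Set.range fun k' : Fin (n₁ + k + 1) =>
            ∑ l : Fin (n₁ + k + 1), (∑ s : Fin 3, b (n₁ + k + 1) l (Fin.castSucc s) • (X s : MvPolynomial (Fin 3) ℂ)) *
              aeval (fun ij : Fin (n₁ + k + 2) × Fin (n₁ + k + 2) => ∑ s : Fin 3,
                  (if ((ij.1 : ℕ) = (ij.2 : ℕ) ∧ n₁ + 1 ≤ (ij.1 : ℕ)) then (0 : ℂ) else b ij.1 ij.2 (Fin.castSucc s)) •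
                    (X s : MvPolynomial (Fin 3) ℂ))
                (pderiv (Fin.castSucc k', Fin.castSucc l) (perPoly (Fin (n₁ + k + 2)) ℂ)))
        ⊔ Submodule.span ℂ (Set.range fun l : Fin (n₁ + k + 1) =>
            ∑ k' : Fin (n₁ + k + 1), (∑ s : Fin 3, b k' (n₁ + k + 1) (Fin.castSucc s) • (X s : MvPolynomial (Fin 3) ℂ)) *
              aeval (fun ij : Fin (n₁ + k + 2) × Fin (n₁ + k + 2) => ∑ s : Fin 3,
                  (if ((ij.1 : ℕ) = (ij.2 : ℕ) ∧ n₁ + 1 ≤ (ij.1 : ℕ)) then (0 : ℂ) else b ij.1 ij.2 (Fin.castSucc s)) •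
                    (X s : MvPolynomial (Fin 3) ℂ))
                (pderiv (Fin.castSucc k', Fin.castSucc l) (perPoly (Fin (n₁ + k + 2)) ℂ)))) + L) :
    ∃ n₀ : ℕ, ∀ n ≥ n₀, ∃ (M : Fin n × Fin n → Fin 4 → ℂ) (c : Fin 4 → Fin n × Fin n),
      IsUnit (Matrix.of fun t t' : Fin 4 => M (c t') t) ∧
      2 * (6 * n / 5) ^ 2 + 6 * n / 5 + 2 ≤
        Module.finrank ℂ ↥(Submodule.span ℂ (Set.range fun tc : Fin 4 × (Fin n × Fin n) =>
          (X tc.1 : MvPolynomial (Fin 4) ℂ) *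
            aeval (fun ij : Fin n × Fin n => ∑ t : Fin 4, M ij t • (X t : MvPolynomial (Fin 4) ℂ))
              (pderiv tc.2 (perPoly (Fin n) ℂ)))) := by
  refine ⟨n₁ + 100 * (n₁ + L + 2) + 1, fun n hn => ?_⟩
  obtain ⟨d, rfl⟩ : ∃ d, n = n₁ + d + 1 := ⟨n - n₁ - 1, by omega⟩
  have hd : 100 * (n₁ + L + 2) ≤ d := by omega
  obtain ⟨M, hM1, -, hM3⟩ := pencilRank_chain2 n₁ b d
  have hle : n₁ + 1 ≤ n₁ + d + 1 := by omega
  refine ⟨M, fun t => (Fin.castLE hle (cells t).1, Fin.castLE hle (cells t).2), ?_, ?_⟩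
  · have hmat : (Matrix.of fun t t' : Fin 4 => M (Fin.castLE hle (cells t').1, Fin.castLE hle (cells t').2) t) =
        Matrix.of fun t t' : Fin 4 => b (cells t').1 (cells t').2 t := by
      ext t t'
      rw [Matrix.of_apply, Matrix.of_apply, hM1 _ _ (Or.inr (by simp [(cells t').1.isLt]))]
      simp
    rw [hmat]
    exact hcells
  · -- arithmetic: `3d² + (6n₁+5)d ≤ s(M) + dL` and `2q² + q + 2 + dL ≤ 3d² + (6n₁+5)d`
    have hsum : ∀ d : ℕ, ∑ k ∈ Finset.range d, (6 * (n₁ + k + 1) + 2) = 3 * d * d + (6 * n₁ + 5) * d := by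
      intro d
      induction d with
      | zero => simp
      | succ d ih => rw [Finset.sum_range_succ, ih]; ring
    have h1 : ∑ k ∈ Finset.range d, (6 * (n₁ + k + 1) + 2) ≤ (∑ k ∈ Finset.range d, Module.finrank ℂ ↥(
        Submodule.span ℂ (Set.range fun s : Fin 3 =>
          (X s : MvPolynomial (Fin 3) ℂ) *
            aeval (fun ij : Fin (n₁ + k + 1) × Fin (n₁ + k + 1) => ∑ s : Fin 3,
                (if ((ij.1 : ℕ) = (ij.2 : ℕ) ∧ n₁ + 1 ≤ (ij.1 : ℕ)) then (0 : ℂ) else b ij.1 ij.2 (Fin.castSucc s)) •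
                  (X s : MvPolynomial (Fin 3) ℂ))
              (perPoly (Fin (n₁ + k + 1)) ℂ))
        ⊔ Submodule.span ℂ (Set.range fun sk : Fin 3 × Fin (n₁ + k + 1) =>
          (X sk.1 : MvPolynomial (Fin 3) ℂ) *
            ∑ l : Fin (n₁ + k + 1), (∑ s : Fin 3, b (n₁ + k + 1) l (Fin.castSucc s) • (X s : MvPolynomial (Fin 3) ℂ)) *
              aeval (fun ij : Fin (n₁ + k + 1) × Fin (n₁ + k + 1) => ∑ s : Fin 3,
                  (if ((ij.1 : ℕ) = (ij.2 : ℕ) ∧ n₁ + 1 ≤ (ij.1 : ℕ)) then (0 : ℂ) else b ij.1 ij.2 (Fin.castSucc s)) •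
                    (X s : MvPolynomial (Fin 3) ℂ))
                (pderiv (sk.2, l) (perPoly (Fin (n₁ + k + 1)) ℂ)))
        ⊔ Submodule.span ℂ (Set.range fun sl : Fin 3 × Fin (n₁ + k + 1) =>
          (X sl.1 : MvPolynomial (Fin 3) ℂ) *
            ∑ k' : Fin (n₁ + k + 1), (∑ s : Fin 3, b k' (n₁ + k + 1) (Fin.castSucc s) • (X s : MvPolynomial (Fin 3) ℂ)) *
              aeval (fun ij : Fin (n₁ + k + 1) × Fin (n₁ + k + 1) => ∑ s : Fin 3,
                  (if ((ij.1 : ℕ) = (ij.2 : ℕ) ∧ n₁ + 1 ≤ (ij.1 : ℕ)) then (0 : ℂ) else b ij.1 ij.2 (Fin.castSucc s)) •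
                    (X s : MvPolynomial (Fin 3) ℂ))
                (pderiv (k', sl.2) (perPoly (Fin (n₁ + k + 1)) ℂ)))
        ⊔ Submodule.span ℂ (Set.range fun k' : Fin (n₁ + k + 1) =>
            ∑ l : Fin (n₁ + k + 1), (∑ s : Fin 3, b (n₁ + k + 1) l (Fin.castSucc s) • (X s : MvPolynomial (Fin 3) ℂ)) *
              aeval (fun ij : Fin (n₁ + k + 2) × Fin (n₁ + k + 2) => ∑ s : Fin 3,
                  (if ((ij.1 : ℕ) = (ij.2 : ℕ) ∧ n₁ + 1 ≤ (ij.1 : ℕ)) then (0 : ℂ) else b ij.1 ij.2 (Fin.castSucc s)) •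
                    (X s : MvPolynomial (Fin 3) ℂ))
                (pderiv (Fin.castSucc k', Fin.castSucc l) (perPoly (Fin (n₁ + k + 2)) ℂ)))
        ⊔ Submodule.span ℂ (Set.range fun l : Fin (n₁ + k + 1) =>
            ∑ k' : Fin (n₁ + k + 1), (∑ s : Fin 3, b k' (n₁ + k + 1) (Fin.castSucc s) • (X s : MvPolynomial (Fin 3) ℂ)) *
              aeval (fun ij : Fin (n₁ + k + 2) × Fin (n₁ + k + 2) => ∑ s : Fin 3,
                  (if ((ij.1 : ℕ) = (ij.2 : ℕ) ∧ n₁ + 1 ≤ (ij.1 : ℕ)) then (0 : ℂ) else b ij.1 ij.2 (Fin.castSucc s)) •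
                    (X s : MvPolynomial (Fin 3) ℂ))
                (pderiv (Fin.castSucc k', Fin.castSucc l) (perPoly (Fin (n₁ + k + 2)) ℂ))))) + d * L := by
      calc ∑ k ∈ Finset.range d, (6 * (n₁ + k + 1) + 2)
          ≤ ∑ k ∈ Finset.range d, (Module.finrank ℂ ↥(
        Submodule.span ℂ (Set.range fun s : Fin 3 =>
          (X s : MvPolynomial (Fin 3) ℂ) *
            aeval (fun ij : Fin (n₁ + k + 1) × Fin (n₁ + k + 1) => ∑ s : Fin 3,
                (if ((ij.1 : ℕ) = (ij.2 : ℕ) ∧ n₁ + 1 ≤ (ij.1 : ℕ)) then (0 : ℂ) else b ij.1 ij.2 (Fin.castSucc s)) •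
                  (X s : MvPolynomial (Fin 3) ℂ))
              (perPoly (Fin (n₁ + k + 1)) ℂ))
        ⊔ Submodule.span ℂ (Set.range fun sk : Fin 3 × Fin (n₁ + k + 1) =>
          (X sk.1 : MvPolynomial (Fin 3) ℂ) *
            ∑ l : Fin (n₁ + k + 1), (∑ s : Fin 3, b (n₁ + k + 1) l (Fin.castSucc s) • (X s : MvPolynomial (Fin 3) ℂ)) *
              aeval (fun ij : Fin (n₁ + k + 1) × Fin (n₁ + k + 1) => ∑ s : Fin 3,
                  (if ((ij.1 : ℕ) = (ij.2 : ℕ) ∧ n₁ + 1 ≤ (ij.1 : ℕ)) then (0 : ℂ) else b ij.1 ij.2 (Fin.castSucc s)) •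
                    (X s : MvPolynomial (Fin 3) ℂ))
                (pderiv (sk.2, l) (perPoly (Fin (n₁ + k + 1)) ℂ)))
        ⊔ Submodule.span ℂ (Set.range fun sl : Fin 3 × Fin (n₁ + k + 1) =>
          (X sl.1 : MvPolynomial (Fin 3) ℂ) *
            ∑ k' : Fin (n₁ + k + 1), (∑ s : Fin 3, b k' (n₁ + k + 1) (Fin.castSucc s) • (X s : MvPolynomial (Fin 3) ℂ)) *
              aeval (fun ij : Fin (n₁ + k + 1) × Fin (n₁ + k + 1) => ∑ s : Fin 3,
                  (if ((ij.1 : ℕ) = (ij.2 : ℕ) ∧ n₁ + 1 ≤ (ij.1 : ℕ)) then (0 : ℂ) else b ij.1 ij.2 (Fin.castSucc s)) •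
                    (X s : MvPolynomial (Fin 3) ℂ))
                (pderiv (k', sl.2) (perPoly (Fin (n₁ + k + 1)) ℂ)))
        ⊔ Submodule.span ℂ (Set.range fun k' : Fin (n₁ + k + 1) =>
            ∑ l : Fin (n₁ + k + 1), (∑ s : Fin 3, b (n₁ + k + 1) l (Fin.castSucc s) • (X s : MvPolynomial (Fin 3) ℂ)) *
              aeval (fun ij : Fin (n₁ + k + 2) × Fin (n₁ + k + 2) => ∑ s : Fin 3,
                  (if ((ij.1 : ℕ) = (ij.2 : ℕ) ∧ n₁ + 1 ≤ (ij.1 : ℕ)) then (0 : ℂ) else b ij.1 ij.2 (Fin.castSucc s)) •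
                    (X s : MvPolynomial (Fin 3) ℂ))
                (pderiv (Fin.castSucc k', Fin.castSucc l) (perPoly (Fin (n₁ + k + 2)) ℂ)))
        ⊔ Submodule.span ℂ (Set.range fun l : Fin (n₁ + k + 1) =>
            ∑ k' : Fin (n₁ + k + 1), (∑ s : Fin 3, b k' (n₁ + k + 1) (Fin.castSucc s) • (X s : MvPolynomial (Fin 3) ℂ)) *
              aeval (fun ij : Fin (n₁ + k + 2) × Fin (n₁ + k + 2) => ∑ s : Fin 3,
                  (if ((ij.1 : ℕ) = (ij.2 : ℕ) ∧ n₁ + 1 ≤ (ij.1 : ℕ)) then (0 : ℂ) else b ij.1 ij.2 (Fin.castSucc s)) •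
                    (X s : MvPolynomial (Fin 3) ℂ))
                (pderiv (Fin.castSucc k', Fin.castSucc l) (perPoly (Fin (n₁ + k + 2)) ℂ)))) + L) := Finset.sum_le_sum fun k _ => hr k
        _ = (∑ k ∈ Finset.range d, Module.finrank ℂ ↥(
        Submodule.span ℂ (Set.range fun s : Fin 3 =>
          (X s : MvPolynomial (Fin 3) ℂ) *
            aeval (fun ij : Fin (n₁ + k + 1) × Fin (n₁ + k + 1) => ∑ s : Fin 3,
                (if ((ij.1 : ℕ) = (ij.2 : ℕ) ∧ n₁ + 1 ≤ (ij.1 : ℕ)) then (0 : ℂ) else b ij.1 ij.2 (Fin.castSucc s)) •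
                  (X s : MvPolynomial (Fin 3) ℂ))
              (perPoly (Fin (n₁ + k + 1)) ℂ))
        ⊔ Submodule.span ℂ (Set.range fun sk : Fin 3 × Fin (n₁ + k + 1) =>
          (X sk.1 : MvPolynomial (Fin 3) ℂ) *
            ∑ l : Fin (n₁ + k + 1), (∑ s : Fin 3, b (n₁ + k + 1) l (Fin.castSucc s) • (X s : MvPolynomial (Fin 3) ℂ)) *
              aeval (fun ij : Fin (n₁ + k + 1) × Fin (n₁ + k + 1) => ∑ s : Fin 3,
                  (if ((ij.1 : ℕ) = (ij.2 : ℕ) ∧ n₁ + 1 ≤ (ij.1 : ℕ)) then (0 : ℂ) else b ij.1 ij.2 (Fin.castSucc s)) •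
                    (X s : MvPolynomial (Fin 3) ℂ))
                (pderiv (sk.2, l) (perPoly (Fin (n₁ + k + 1)) ℂ)))
        ⊔ Submodule.span ℂ (Set.range fun sl : Fin 3 × Fin (n₁ + k + 1) =>
          (X sl.1 : MvPolynomial (Fin 3) ℂ) *
            ∑ k' : Fin (n₁ + k + 1), (∑ s : Fin 3, b k' (n₁ + k + 1) (Fin.castSucc s) • (X s : MvPolynomial (Fin 3) ℂ)) *
              aeval (fun ij : Fin (n₁ + k + 1) × Fin (n₁ + k + 1) => ∑ s : Fin 3,
                  (if ((ij.1 : ℕ) = (ij.2 : ℕ) ∧ n₁ + 1 ≤ (ij.1 : ℕ)) then (0 : ℂ) else b ij.1 ij.2 (Fin.castSucc s)) •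
                    (X s : MvPolynomial (Fin 3) ℂ))
                (pderiv (k', sl.2) (perPoly (Fin (n₁ + k + 1)) ℂ)))
        ⊔ Submodule.span ℂ (Set.range fun k' : Fin (n₁ + k + 1) =>
            ∑ l : Fin (n₁ + k + 1), (∑ s : Fin 3, b (n₁ + k + 1) l (Fin.castSucc s) • (X s : MvPolynomial (Fin 3) ℂ)) *
              aeval (fun ij : Fin (n₁ + k + 2) × Fin (n₁ + k + 2) => ∑ s : Fin 3,
                  (if ((ij.1 : ℕ) = (ij.2 : ℕ) ∧ n₁ + 1 ≤ (ij.1 : ℕ)) then (0 : ℂ) else b ij.1 ij.2 (Fin.castSucc s)) •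
                    (X s : MvPolynomial (Fin 3) ℂ))
                (pderiv (Fin.castSucc k', Fin.castSucc l) (perPoly (Fin (n₁ + k + 2)) ℂ)))
        ⊔ Submodule.span ℂ (Set.range fun l : Fin (n₁ + k + 1) =>
            ∑ k' : Fin (n₁ + k + 1), (∑ s : Fin 3, b k' (n₁ + k + 1) (Fin.castSucc s) • (X s : MvPolynomial (Fin 3) ℂ)) *
              aeval (fun ij : Fin (n₁ + k + 2) × Fin (n₁ + k + 2) => ∑ s : Fin 3,
                  (if ((ij.1 : ℕ) = (ij.2 : ℕ) ∧ n₁ + 1 ≤ (ij.1 : ℕ)) then (0 : ℂ) else b ij.1 ij.2 (Fin.castSucc s)) •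
                    (X s : MvPolynomial (Fin 3) ℂ))
                (pderiv (Fin.castSucc k', Fin.castSucc l) (perPoly (Fin (n₁ + k + 2)) ℂ))))) + d * L := by
          rw [Finset.sum_add_distrib, Finset.sum_const, Finset.card_range, smul_eq_mul]
    rw [hsum] at h1
    have hq5 : 5 * (6 * (n₁ + d + 1) / 5) ≤ 6 * (n₁ + d + 1) := Nat.mul_div_le _ _
    have key : 2 * (6 * (n₁ + d + 1) / 5) ^ 2 + 6 * (n₁ + d + 1) / 5 + 2 + d * L ≤
        3 * d * d + (6 * n₁ + 5) * d := by
      nlinarith [hq5, Nat.mul_le_mul hq5 hq5, Nat.mul_le_mul_right d hd, Nat.mul_le_mul_left (n₁ + 2) hd,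
        Nat.zero_le (n₁ * L), Nat.zero_le n₁, Nat.zero_le L]
    omega

/-- **The registered stub from second-order border ranks of one pattern.**  Bounded-corank border ranks of ONE explicit pattern
`b` (hypotheses of `pencilCertificate_of_borderRanks`) imply `stub_fourRowPencilRank` of line
`four-row-count` VERBATIM (through `fourRowPencilRank_of_pencilCertificate`, p112144): the crux's
per-side heart is reduced to a linear-size rank statement per size. [this crux, line four-row-count] -/
theorem fourRowPencilRank_of_borderRanks2 (n₁ : ℕ) (b : ℕ → ℕ → Fin 4 → ℂ)
    (cells : Fin 4 → Fin (n₁ + 1) × Fin (n₁ + 1))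
    (hcells : IsUnit (Matrix.of fun t t' : Fin 4 => b (cells t').1 (cells t').2 t)) (L : ℕ)
    (hr : ∀ k : ℕ, 6 * (n₁ + k + 1) + 2 ≤ Module.finrank ℂ ↥(
        Submodule.span ℂ (Set.range fun s : Fin 3 =>
          (X s : MvPolynomial (Fin 3) ℂ) *
            aeval (fun ij : Fin (n₁ + k + 1) × Fin (n₁ + k + 1) => ∑ s : Fin 3,
                (if ((ij.1 : ℕ) = (ij.2 : ℕ) ∧ n₁ + 1 ≤ (ij.1 : ℕ)) then (0 : ℂ) else b ij.1 ij.2 (Fin.castSucc s)) •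
                  (X s : MvPolynomial (Fin 3) ℂ))
              (perPoly (Fin (n₁ + k + 1)) ℂ))
        ⊔ Submodule.span ℂ (Set.range fun sk : Fin 3 × Fin (n₁ + k + 1) =>
          (X sk.1 : MvPolynomial (Fin 3) ℂ) *
            ∑ l : Fin (n₁ + k + 1), (∑ s : Fin 3, b (n₁ + k + 1) l (Fin.castSucc s) • (X s : MvPolynomial (Fin 3) ℂ)) *
              aeval (fun ij : Fin (n₁ + k + 1) × Fin (n₁ + k + 1) => ∑ s : Fin 3,
                  (if ((ij.1 : ℕ) = (ij.2 : ℕ) ∧ n₁ + 1 ≤ (ij.1 : ℕ)) then (0 : ℂ) else b ij.1 ij.2 (Fin.castSucc s)) •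
                    (X s : MvPolynomial (Fin 3) ℂ))
                (pderiv (sk.2, l) (perPoly (Fin (n₁ + k + 1)) ℂ)))
        ⊔ Submodule.span ℂ (Set.range fun sl : Fin 3 × Fin (n₁ + k + 1) =>
          (X sl.1 : MvPolynomial (Fin 3) ℂ) *
            ∑ k' : Fin (n₁ + k + 1), (∑ s : Fin 3, b k' (n₁ + k + 1) (Fin.castSucc s) • (X s : MvPolynomial (Fin 3) ℂ)) *
              aeval (fun ij : Fin (n₁ + k + 1) × Fin (n₁ + k + 1) => ∑ s : Fin 3,
                  (if ((ij.1 : ℕ) = (ij.2 : ℕ) ∧ n₁ + 1 ≤ (ij.1 : ℕ)) then (0 : ℂ) else b ij.1 ij.2 (Fin.castSucc s)) •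
                    (X s : MvPolynomial (Fin 3) ℂ))
                (pderiv (k', sl.2) (perPoly (Fin (n₁ + k + 1)) ℂ)))
        ⊔ Submodule.span ℂ (Set.range fun k' : Fin (n₁ + k + 1) =>
            ∑ l : Fin (n₁ + k + 1), (∑ s : Fin 3, b (n₁ + k + 1) l (Fin.castSucc s) • (X s : MvPolynomial (Fin 3) ℂ)) *
              aeval (fun ij : Fin (n₁ + k + 2) × Fin (n₁ + k + 2) => ∑ s : Fin 3,
                  (if ((ij.1 : ℕ) = (ij.2 : ℕ) ∧ n₁ + 1 ≤ (ij.1 : ℕ)) then (0 : ℂ) else b ij.1 ij.2 (Fin.castSucc s)) •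
                    (X s : MvPolynomial (Fin 3) ℂ))
                (pderiv (Fin.castSucc k', Fin.castSucc l) (perPoly (Fin (n₁ + k + 2)) ℂ)))
        ⊔ Submodule.span ℂ (Set.range fun l : Fin (n₁ + k + 1) =>
            ∑ k' : Fin (n₁ + k + 1), (∑ s : Fin 3, b k' (n₁ + k + 1) (Fin.castSucc s) • (X s : MvPolynomial (Fin 3) ℂ)) *
              aeval (fun ij : Fin (n₁ + k + 2) × Fin (n₁ + k + 2) => ∑ s : Fin 3,
                  (if ((ij.1 : ℕ) = (ij.2 : ℕ) ∧ n₁ + 1 ≤ (ij.1 : ℕ)) then (0 : ℂ) else b ij.1 ij.2 (Fin.castSucc s)) •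
                    (X s : MvPolynomial (Fin 3) ℂ))
                (pderiv (Fin.castSucc k', Fin.castSucc l) (perPoly (Fin (n₁ + k + 2)) ℂ)))) + L) :
    ∃ n₀ : ℕ, ∀ n ≥ n₀, ∀ (m : ℕ) [NeZero m], n ≤ m → 5 * m ≤ 6 * n →
      ∃ g : GL (MatIdx m) ℂ, 2 * m ^ 2 + m + 2 ≤ Module.finrank ℂ ↥(Submodule.span ℂ (Set.range fun ab : {a : MatIdx m // m * m ≤ (((matIdxEquiv m).symm a : Fin (m * m)) : ℕ) + 4} × MatIdx m => (MvPolynomial.X ab.1.1 : MvPolynomial (MatIdx m) ℂ) * MvPolynomial.aeval (fun i : MatIdx m => if m * m ≤ (((matIdxEquiv m).symm i : Fin (m * m)) : ℕ) + 4 then (MvPolynomial.X i : MvPolynomial (MatIdx m) ℂ) else 0) (MvPolynomial.pderiv ab.2 (linSubst (MatIdx m) ℂ ((g : GL (MatIdx m) ℂ) : Matrix (MatIdx m) (MatIdx m) ℂ) (paddedPerFormLex ℂ n m))))) :=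
  fourRowPencilRank_of_pencilCertificate (pencilCertificate_of_borderRanks2 n₁ b cells hcells L hr)

end Summit.ValiantsHypothesis.ValiantsHypothesis.Theorems.ValuativeFlip
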